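import Mathlib.Analysis.Normed.Operator.Mul
import Literature.Analysis.FunctionSpaces.ContDiffHolderSpace
import Literature.Analysis.FunctionSpaces.ContDiffHolderLeibniz
import HarnessLib

/-!
# `C^{k,r}_b` is an algebra: bounded bilinear pairings of Hölder functions (Hölder spaces, part 5)

Topic `Literature/Analysis/FunctionSpaces`. For the Banach spaces `C^{k,r}_b(E, ·)` of part 3
(`ContDiffHolderFunction`, `ContDiffHolderSpace.lean`) and a continuous bilinear map
`B : Y₁ →L[ℝ] Y₂ →L[ℝ] Z`, the pointwise pairing `x ↦ B (f x) (g x)` of `f ∈ C^{k,r}_b(E, Y₁)`,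
`g ∈ C^{k,r}_b(E, Y₂)` lies in `C^{k,r}_b(E, Z)` with
`‖B(f, g)‖_{C^{k,r}} ≤ (k+1)·9ᵏ·‖B‖·‖f‖_{C^{k,r}}·‖g‖_{C^{k,r}}` (`0 ≤ r ≤ 1`): this is the
bundled form of the tree's Leibniz estimate `eContDiffHolderNorm_bilinear_le`
(`ContDiffHolderLeibniz.lean`; Gilbarg–Trudinger 2001, §4.1 (4.7): "the product of functions in
`C^{k,α}` is in `C^{k,α}`"; Buckmaster–De Lellis–Székelyhidi–Vicol 2019, App. A (A.2)), combined
with the comparison of lower-order norms `‖f‖_{C^{j,r}} ≤ 3^{k−j}‖f‖_{C^{k,r}}`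
(`eContDiffHolderNorm_le_pow_mul_of_le`, from `eContDiffHolderNorm_le_three_mul_succ`).

* `MemContDiffHolder.of_eContDiffHolderNorm_lt_top` — membership from finiteness of the norm;
* `eContDiffHolderNorm_le_pow_mul_of_le` — lower-order norms;
* `MemContDiffHolder.bilinear`, `ContDiffHolderFunction.bilinear`, `norm_bilinear_le`,
  `bilinearCLM` — the pairing as a continuous bilinear map of Banach spaces;
* `ContDiffHolderFunction.mul`, `smulRight` — products of real Hölder functions and
  multiplication of vector-valued by real-valued Hölder functions (universe-`0` targets, as the
  tree's Leibniz estimate is stated in one universe).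

Everything is proved; no named facts. Brick (1c) of the analytic core recorded in the census of
`Literature.Geometry.Riemannian.gurskyViaclovsky_pathOpen_weighted_four` (products of Hölder
functions: the coefficients of the linearised operator and the nonlinearity are polynomial in the
jets).

## References

* D. Gilbarg, N. S. Trudinger, *Elliptic Partial Differential Equations of Second Order* (2001),
  §4.1, (4.7). [GilbargTrudinger2001]
-/

noncomputable section

open Set Filter
open scoped NNReal ENNReal

universe u

namespace Literature.Analysis.FunctionSpaces

/-! ### Membership from finiteness of the norm; lower-order norms -/

section General

variable {E F : Type*} [NormedAddCommGroup E] [NormedSpace ℝ E] [NormedAddCommGroup F]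
  [NormedSpace ℝ F] {k : ℕ} {r : ℝ≥0}

/-- A `C^k` map with finite `C^{k,r}` norm is in the class `C^{k,r}_b`. [folklore] -/
theorem MemContDiffHolder.of_eContDiffHolderNorm_lt_top {f : E → F} (hf : ContDiff ℝ k f)
    (h : eContDiffHolderNorm k r f < ⊤) : MemContDiffHolder k r f := by
  refine ⟨hf, fun j hj => ?_, ?_⟩
  · exact lt_of_le_of_lt (iSup_le fun x => enorm_iteratedFDeriv_le_eContDiffHolderNorm hj r f x) h
  · exact eHolderNorm_lt_top.1
      (lt_of_le_of_lt (eHolderNorm_iteratedFDeriv_le_eContDiffHolderNorm k r f) h)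

/-- **Lower-order norms**: `‖f‖_{C^{j,r}} ≤ 3^{k−j} ‖f‖_{C^{k,r}}` for `C^k` maps, `j ≤ k`, `r ≤ 1`
(iterate `‖f‖_{C^{k,r}} ≤ 3‖f‖_{C^{k+1,r}}`, `eContDiffHolderNorm_le_three_mul_succ`). [folklore] -/
theorem eContDiffHolderNorm_le_pow_mul_of_le (hr : r ≤ 1) {f : E → F} :
    ∀ {k j : ℕ}, ContDiff ℝ k f → j ≤ k →
      eContDiffHolderNorm j r f ≤ 3 ^ (k - j) * eContDiffHolderNorm k r f := by
  intro k
  induction k with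
  | zero =>
    intro j _ hj
    rw [Nat.le_zero.1 hj]
    simp
  | succ k ih =>
    intro j hf hj
    rcases Nat.of_le_succ hj with hjk | hjk
    · calc eContDiffHolderNorm j r f ≤ 3 ^ (k - j) * eContDiffHolderNorm k r f :=
            ih (hf.of_le (by exact_mod_cast Nat.le_succ k)) hjk
        _ ≤ 3 ^ (k - j) * (3 * eContDiffHolderNorm (k + 1) r f) :=
            mul_le_mul' le_rfl (eContDiffHolderNorm_le_three_mul_succ hf hr r)
        _ = 3 ^ (k + 1 - j) * eContDiffHolderNorm (k + 1) r f := by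
            rw [Nat.succ_sub hjk, pow_succ, mul_assoc]
    · rw [hjk]
      simp

namespace ContDiffHolderFunction

/-- Elements of `C^{k,r}_b` have finite extended `C^{k,r}` norm. [folklore] -/
theorem eContDiffHolderNorm_lt_top (f : ContDiffHolderFunction E F k r) :
    eContDiffHolderNorm k r (f : E → F) < ⊤ :=
  f.memContDiffHolder.eContDiffHolderNorm_lt_top

/-- The norm read in `ℝ≥0∞` is the extended `C^{k,r}` norm. [folklore] -/
theorem ofReal_norm_eq (f : ContDiffHolderFunction E F k r) :
    ENNReal.ofReal ‖f‖ = eContDiffHolderNorm k r (f : E → F) := by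
  rw [norm_eq_toReal_eContDiffHolderNorm, ENNReal.ofReal_toReal f.eContDiffHolderNorm_lt_top.ne]

/-- Lower-order norms of an element: `‖f‖_{C^{j,r}} ≤ 3^{k−j}·ofReal ‖f‖` (`j ≤ k`, `r ≤ 1`). [folklore] -/
theorem eContDiffHolderNorm_le_of_le (hr : r ≤ 1) (f : ContDiffHolderFunction E F k r) {j : ℕ}
    (hj : j ≤ k) : eContDiffHolderNorm j r (f : E → F) ≤ 3 ^ (k - j) * ENNReal.ofReal ‖f‖ := by
  rw [f.ofReal_norm_eq]
  exact eContDiffHolderNorm_le_pow_mul_of_le hr f.contDiff hj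

end ContDiffHolderFunction

end General

/-! ### Bilinear pairings -/

section Bilinear

variable {E Y₁ Y₂ Z : Type u} [NormedAddCommGroup E] [NormedSpace ℝ E]
  [NormedAddCommGroup Y₁] [NormedSpace ℝ Y₁] [NormedAddCommGroup Y₂] [NormedSpace ℝ Y₂]
  [NormedAddCommGroup Z] [NormedSpace ℝ Z] {k : ℕ} {r : ℝ≥0}

/-- **`C^{k,r}_b` is closed under continuous bilinear pairings** (`r ≤ 1`): from the tree's
Leibniz estimate `eContDiffHolderNorm_bilinear_le` and the finiteness of the lower-order norms.
[cite: GilbargTrudinger2001, §4.1 (4.7)] -/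
theorem MemContDiffHolder.bilinear (hr : r ≤ 1) (B : Y₁ →L[ℝ] Y₂ →L[ℝ] Z) {f : E → Y₁} {g : E → Y₂}
    (hf : MemContDiffHolder k r f) (hg : MemContDiffHolder k r g) :
    MemContDiffHolder k r (fun x => B (f x) (g x)) := by
  refine MemContDiffHolder.of_eContDiffHolderNorm_lt_top
    (B.isBoundedBilinearMap.contDiff.comp₂ hf.1 hg.1) ?_
  refine lt_of_le_of_lt (eContDiffHolderNorm_bilinear_le B hf.1 hg.1 r) ?_
  refine ENNReal.mul_lt_top (ENNReal.mul_lt_top (by simp) enorm_lt_top) ?_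
  refine ENNReal.sum_lt_top.2 fun j hj => ENNReal.mul_lt_top ?_ ?_
  · have hjk : j ≤ k := Nat.lt_succ_iff.1 (Finset.mem_range.1 hj)
    exact lt_of_le_of_lt (eContDiffHolderNorm_le_pow_mul_of_le hr hf.1 hjk)
      (ENNReal.mul_lt_top (by simp) hf.eContDiffHolderNorm_lt_top)
  · exact lt_of_le_of_lt (eContDiffHolderNorm_le_pow_mul_of_le hr hg.1 (Nat.sub_le k j))
      (ENNReal.mul_lt_top (by simp) hg.eContDiffHolderNorm_lt_top)

namespace ContDiffHolderFunction

/-- **The bilinear pairing of Hölder functions** `x ↦ B (f x) (g x)` as an element of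
`C^{k,r}_b(E, Z)` (`r ≤ 1`). [cite: GilbargTrudinger2001, §4.1 (4.7)] -/
def bilinear (hr : r ≤ 1) (B : Y₁ →L[ℝ] Y₂ →L[ℝ] Z) (f : ContDiffHolderFunction E Y₁ k r)
    (g : ContDiffHolderFunction E Y₂ k r) : ContDiffHolderFunction E Z k r :=
  ⟨fun x => B (f x) (g x), f.memContDiffHolder.bilinear hr B g.memContDiffHolder⟩

/-- Pointwise: `bilinear hr B f g x = B (f x) (g x)`. [folklore] -/
@[simp]
theorem bilinear_apply (hr : r ≤ 1) (B : Y₁ →L[ℝ] Y₂ →L[ℝ] Z) (f : ContDiffHolderFunction E Y₁ k r)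
    (g : ContDiffHolderFunction E Y₂ k r) (x : E) : bilinear hr B f g x = B (f x) (g x) := rfl

/-- **The Leibniz bound** `‖B(f, g)‖_{C^{k,r}} ≤ (k+1)·9ᵏ·‖B‖·‖f‖_{C^{k,r}}·‖g‖_{C^{k,r}}`
(`r ≤ 1`; `eContDiffHolderNorm_bilinear_le` with `‖f‖_{C^{j,r}} ≤ 3^{k−j}‖f‖_{C^{k,r}}`,
`‖g‖_{C^{k−j,r}} ≤ 3^{j}‖g‖_{C^{k,r}}`). [cite: GilbargTrudinger2001, §4.1 (4.7)] -/
theorem norm_bilinear_le (hr : r ≤ 1) (B : Y₁ →L[ℝ] Y₂ →L[ℝ] Z) (f : ContDiffHolderFunction E Y₁ k r)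
    (g : ContDiffHolderFunction E Y₂ k r) :
    ‖bilinear hr B f g‖ ≤ ((k + 1) * 9 ^ k * ‖B‖) * ‖f‖ * ‖g‖ := by
  -- the estimate in `ℝ≥0∞`
  have hterm : ∀ j ∈ Finset.range (k + 1),
      eContDiffHolderNorm j r (f : E → Y₁) * eContDiffHolderNorm (k - j) r (g : E → Y₂) ≤
        3 ^ k * (ENNReal.ofReal ‖f‖ * ENNReal.ofReal ‖g‖) := by
    intro j hj
    have hjk : j ≤ k := Nat.lt_succ_iff.1 (Finset.mem_range.1 hj)
    calc eContDiffHolderNorm j r (f : E → Y₁) * eContDiffHolderNorm (k - j) r (g : E → Y₂)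
        ≤ (3 ^ (k - j) * ENNReal.ofReal ‖f‖) * (3 ^ (k - (k - j)) * ENNReal.ofReal ‖g‖) :=
          mul_le_mul' (f.eContDiffHolderNorm_le_of_le hr hjk)
            (g.eContDiffHolderNorm_le_of_le hr (Nat.sub_le k j))
      _ = 3 ^ k * (ENNReal.ofReal ‖f‖ * ENNReal.ofReal ‖g‖) := by
          rw [Nat.sub_sub_self hjk, show (3 : ℝ≥0∞) ^ (k - j) * ENNReal.ofReal ‖f‖ *
              (3 ^ j * ENNReal.ofReal ‖g‖) = (3 ^ (k - j) * 3 ^ j) *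
              (ENNReal.ofReal ‖f‖ * ENNReal.ofReal ‖g‖) by ring, ← pow_add, Nat.sub_add_cancel hjk]
  have hE : eContDiffHolderNorm k r ((bilinear hr B f g : ContDiffHolderFunction E Z k r) : E → Z) ≤
      3 ^ k * ‖B‖ₑ * ((k + 1 : ℕ) * (3 ^ k * (ENNReal.ofReal ‖f‖ * ENNReal.ofReal ‖g‖))) := by
    refine (eContDiffHolderNorm_bilinear_le B f.contDiff g.contDiff r).trans ?_
    refine mul_le_mul' le_rfl ?_
    calc ∑ j ∈ Finset.range (k + 1),
          eContDiffHolderNorm j r (f : E → Y₁) * eContDiffHolderNorm (k - j) r (g : E → Y₂)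
        ≤ ∑ _j ∈ Finset.range (k + 1), 3 ^ k * (ENNReal.ofReal ‖f‖ * ENNReal.ofReal ‖g‖) :=
          Finset.sum_le_sum hterm
      _ = (k + 1 : ℕ) * (3 ^ k * (ENNReal.ofReal ‖f‖ * ENNReal.ofReal ‖g‖)) := by
          rw [Finset.sum_const, Finset.card_range, nsmul_eq_mul]
  -- read in `ℝ`
  have hC : 0 ≤ ((k + 1) * 9 ^ k * ‖B‖) * ‖f‖ * ‖g‖ := by positivity
  rw [← ENNReal.ofReal_le_ofReal_iff hC, ofReal_norm_eq]
  refine hE.trans (le_of_eq ?_)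
  rw [← ofReal_norm, show ((k + 1 : ℕ) : ℝ≥0∞) = ENNReal.ofReal ((k + 1 : ℕ) : ℝ) by
      rw [ENNReal.ofReal_natCast], show (3 : ℝ≥0∞) ^ k = ENNReal.ofReal ((3 : ℝ) ^ k) by
      rw [ENNReal.ofReal_pow (by norm_num), ENNReal.ofReal_ofNat],
    ← ENNReal.ofReal_mul (by positivity), ← ENNReal.ofReal_mul (by positivity),
    ← ENNReal.ofReal_mul (by positivity), ← ENNReal.ofReal_mul (by positivity),
    ← ENNReal.ofReal_mul (by positivity)]
  congr 1
  push_cast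
  rw [show (9 : ℝ) ^ k = 3 ^ k * 3 ^ k by rw [← mul_pow]; norm_num]
  ring

/-- The pairing is additive in the first factor. [folklore] -/
theorem bilinear_add_left (hr : r ≤ 1) (B : Y₁ →L[ℝ] Y₂ →L[ℝ] Z)
    (f f' : ContDiffHolderFunction E Y₁ k r) (g : ContDiffHolderFunction E Y₂ k r) :
    bilinear hr B (f + f') g = bilinear hr B f g + bilinear hr B f' g :=
  ContDiffHolderFunction.ext fun x => by simp [map_add]

/-- The pairing is additive in the second factor. [folklore] -/
theorem bilinear_add_right (hr : r ≤ 1) (B : Y₁ →L[ℝ] Y₂ →L[ℝ] Z)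
    (f : ContDiffHolderFunction E Y₁ k r) (g g' : ContDiffHolderFunction E Y₂ k r) :
    bilinear hr B f (g + g') = bilinear hr B f g + bilinear hr B f g' :=
  ContDiffHolderFunction.ext fun x => by simp [map_add]

/-- The pairing is homogeneous in the first factor. [folklore] -/
theorem bilinear_smul_left (hr : r ≤ 1) (B : Y₁ →L[ℝ] Y₂ →L[ℝ] Z) (a : ℝ)
    (f : ContDiffHolderFunction E Y₁ k r) (g : ContDiffHolderFunction E Y₂ k r) :
    bilinear hr B (a • f) g = a • bilinear hr B f g :=
  ContDiffHolderFunction.ext fun x => by simp [map_smul]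

/-- The pairing is homogeneous in the second factor. [folklore] -/
theorem bilinear_smul_right (hr : r ≤ 1) (B : Y₁ →L[ℝ] Y₂ →L[ℝ] Z) (a : ℝ)
    (f : ContDiffHolderFunction E Y₁ k r) (g : ContDiffHolderFunction E Y₂ k r) :
    bilinear hr B f (a • g) = a • bilinear hr B f g :=
  ContDiffHolderFunction.ext fun x => by simp [map_smul]

/-- **The pairing as a continuous bilinear map of Banach spaces**
`C^{k,r}_b(E, Y₁) →L[ℝ] C^{k,r}_b(E, Y₂) →L[ℝ] C^{k,r}_b(E, Z)` (`r ≤ 1`). [cite: GilbargTrudinger2001, §4.1 (4.7)] -/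
def bilinearCLM (hr : r ≤ 1) (B : Y₁ →L[ℝ] Y₂ →L[ℝ] Z) :
    ContDiffHolderFunction E Y₁ k r →L[ℝ] ContDiffHolderFunction E Y₂ k r →L[ℝ]
      ContDiffHolderFunction E Z k r :=
  LinearMap.mkContinuous₂
    (LinearMap.mk₂ ℝ (bilinear hr B) (bilinear_add_left hr B) (bilinear_smul_left hr B)
      (bilinear_add_right hr B) (bilinear_smul_right hr B))
    ((k + 1) * 9 ^ k * ‖B‖) (norm_bilinear_le hr B)

/-- `bilinearCLM hr B f g = bilinear hr B f g`. [folklore] -/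
@[simp]
theorem bilinearCLM_apply (hr : r ≤ 1) (B : Y₁ →L[ℝ] Y₂ →L[ℝ] Z)
    (f : ContDiffHolderFunction E Y₁ k r) (g : ContDiffHolderFunction E Y₂ k r) :
    bilinearCLM hr B f g = bilinear hr B f g := rfl

end ContDiffHolderFunction

end Bilinear

/-! ### Products with real Hölder functions -/

section Real

variable {E F : Type} [NormedAddCommGroup E] [NormedSpace ℝ E] [NormedAddCommGroup F]
  [NormedSpace ℝ F] {k : ℕ} {r : ℝ≥0}

namespace ContDiffHolderFunction

/-- **Product of real Hölder functions** (`C^{k,r}_b(E, ℝ)` is a Banach algebra up to the constant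
`(k+1)9ᵏ`, `r ≤ 1`). [cite: GilbargTrudinger2001, §4.1 (4.7)] -/
def mul (hr : r ≤ 1) (f g : ContDiffHolderFunction E ℝ k r) : ContDiffHolderFunction E ℝ k r :=
  bilinear hr (ContinuousLinearMap.mul ℝ ℝ) f g

/-- Pointwise: `mul hr f g x = f x * g x`. [folklore] -/
@[simp]
theorem mul_apply (hr : r ≤ 1) (f g : ContDiffHolderFunction E ℝ k r) (x : E) :
    mul hr f g x = f x * g x := rfl

/-- `‖f g‖_{C^{k,r}} ≤ (k+1)·9ᵏ·‖f‖_{C^{k,r}}·‖g‖_{C^{k,r}}`. [cite: GilbargTrudinger2001, §4.1 (4.7)] -/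
theorem norm_mul_le (hr : r ≤ 1) (f g : ContDiffHolderFunction E ℝ k r) :
    ‖mul hr f g‖ ≤ ((k + 1) * 9 ^ k) * ‖f‖ * ‖g‖ := by
  refine (norm_bilinear_le hr (ContinuousLinearMap.mul ℝ ℝ) f g).trans ?_
  have h1 : ‖ContinuousLinearMap.mul ℝ ℝ‖ ≤ 1 := ContinuousLinearMap.opNorm_mul_le ℝ ℝ
  have h0 : 0 ≤ ‖f‖ * ‖g‖ := by positivity
  nlinarith [norm_nonneg (ContinuousLinearMap.mul ℝ ℝ), pow_pos (by norm_num : (0 : ℝ) < 9) k,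
    mul_nonneg (mul_nonneg (by positivity : (0 : ℝ) ≤ (k + 1) * 9 ^ k) h0)
      (sub_nonneg.2 h1)]

/-- **Multiplication of a vector-valued by a real-valued Hölder function**: `x ↦ f x • u x`
(`r ≤ 1`). [cite: GilbargTrudinger2001, §4.1 (4.7)] -/
def smulRight (hr : r ≤ 1) (f : ContDiffHolderFunction E ℝ k r) (u : ContDiffHolderFunction E F k r) :
    ContDiffHolderFunction E F k r :=
  bilinear hr (ContinuousLinearMap.lsmul ℝ ℝ) f u

/-- Pointwise: `smulRight hr f u x = f x • u x`. [folklore] -/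
@[simp]
theorem smulRight_apply (hr : r ≤ 1) (f : ContDiffHolderFunction E ℝ k r)
    (u : ContDiffHolderFunction E F k r) (x : E) : smulRight hr f u x = f x • u x := rfl

/-- `‖f • u‖_{C^{k,r}} ≤ (k+1)·9ᵏ·‖f‖_{C^{k,r}}·‖u‖_{C^{k,r}}`. [cite: GilbargTrudinger2001, §4.1 (4.7)] -/
theorem norm_smulRight_le (hr : r ≤ 1) (f : ContDiffHolderFunction E ℝ k r)
    (u : ContDiffHolderFunction E F k r) :
    ‖smulRight hr f u‖ ≤ ((k + 1) * 9 ^ k) * ‖f‖ * ‖u‖ := by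
  refine (norm_bilinear_le hr (ContinuousLinearMap.lsmul ℝ ℝ) f u).trans ?_
  have h1 : ‖(ContinuousLinearMap.lsmul ℝ ℝ : ℝ →L[ℝ] F →L[ℝ] F)‖ ≤ 1 :=
    ContinuousLinearMap.opNorm_lsmul_le
  have h0 : 0 ≤ ‖f‖ * ‖u‖ := by positivity
  nlinarith [norm_nonneg (ContinuousLinearMap.lsmul ℝ ℝ : ℝ →L[ℝ] F →L[ℝ] F),
    pow_pos (by norm_num : (0 : ℝ) < 9) k,
    mul_nonneg (mul_nonneg (by positivity : (0 : ℝ) ≤ (k + 1) * 9 ^ k) h0) (sub_nonneg.2 h1)]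

end ContDiffHolderFunction

end Real

end Literature.Analysis.FunctionSpaces

end
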